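import Summits.BirchSwinnertonDyer.BirchSwinnertonDyer.Theorems.TameQuarticSolventSolventPairLowerBoundTprimePadicForm
import Summits.BirchSwinnertonDyer.Rank1Residual.Additive.KodairaDictionaryThree
import Literature.NumberTheory.DiophantineGeometry.TateAlgorithmEvalProofs
import Literature.NumberTheory.DiophantineGeometry.TateAlgorithmIstarEvalProofs
import Literature.NumberTheory.EllipticCurves.QuadraticTwistPadicReduction
import Literature.NumberTheory.EllipticCurves.QuadraticTwistJInvariantProofs
import HarnessLib

/-!
# Route `TameQuarticSolvent`, crux `SolventPairLowerBound` (stmt-BirchSwinnertonDyer-21391), line `birth` —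
# twist bookkeeping for `stub_twistDatum`: **the census class (t′) at `3` is preserved by a quadratic twist
# with `ord₃ d = 1`** (Kodaira `III ↦ III*`, `III* ↦ III`)

HONEST FRAMING. Theorems only; helper (`--supports stmt-BirchSwinnertonDyer-21391 --as helper`) towards the
stub `stub_twistDatum` (whose remaining content is the analytic input: a Friedberg–Hoffstein twist with
`L(E^{(d)}, 1) ≠ 0` in the prescribed local class — not in the tree). BSD is not proved by any of this.

WHAT. For `W/ℚ` globally minimal, elliptic, additive at `3` of census class (t′) (`Addv W 3`,
`Additive.SubTprime W 3`), an integer `d` with `ord₃ d = 1`, and ANY globally minimal model `Wd` of the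
quadratic twist `W^{(d)}`:
* `kodairaSymbolAt_placeOf_three_of_twist` — the Kodaira symbol of `Wd` at `3` is `III*` if that of `W` is
  `III`, and `III` if that of `W` is `III*`;
* `addv_and_subTprime_of_twist_three` — `Addv Wd 3 ∧ SubTprime Wd 3`.
Proof: on the `ℤ₃` medium form `S = y² = x³ + A₂x² + A₄x + A₆` of `exists_padicInt_mediumForm_of_subTprime`
the twist is `y² = x³ + dA₂x² + d²A₄x + d³A₆` (`quadraticTwist_smul`, `map_quadraticTwist`), a Step-9 model of
type `III*` resp. — `(x, y)` divided by `(3², 3³)` — a Step-2 model of type `III` (tree forward evaluations),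
minimal since `ord Δ < 12`; the symbol of `Wd` is read on it (`kodairaSymbol_eq_kodairaSymbolOfMinimal_of_isMinimal`)
and (t′) follows from the b2b dictionary `Additive.subTprime_three_iff_kodairaSymbolAt_III_or_IIIstar`.

References: J. H. Silverman, *ATAEC* IV.9.4 (Steps 2–4, 9) and Table 4.1; *AEC* VII.1 Prop. 1.3, X.5 Cor. 5.4.
-/

-- D-0017: single-problem summit, so `Summit.BirchSwinnertonDyer.BirchSwinnertonDyer.…` repeats a namespace BY DESIGN.
set_option linter.dupNamespace false

noncomputable section

open IsLocalRing IsDedekindDomain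
open IsDiscreteValuationRing hiding maximalIdeal
open Literature Literature.NumberTheory.DiophantineGeometry
  Literature.NumberTheory.DiophantineGeometry.TateAlgorithm
  Literature.NumberTheory.EllipticCurves Literature.NumberTheory.EllipticCurves.Rizzo
  Literature.NumberTheory.EllipticCurves.Rank1Residual
  Summit.BirchSwinnertonDyer.Rank1Residual.Additive

namespace Summit.BirchSwinnertonDyer.BirchSwinnertonDyer.Theorems.SolventPairLowerBound

/-- `W.kodairaSymbolAt (placeOf p)` (the currency of the b2b census dictionary) is Tate's algorithm over
Mathlib's `ℤ_p` (tree `WeierstrassCurve.kodairaSymbolAt_eq_padic`). [folklore] -/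
theorem kodairaSymbolAt_placeOf_eq_padic (p : ℕ) [Fact p.Prime] (W : WeierstrassCurve ℚ) [W.IsElliptic] :
    W.kodairaSymbolAt (placeOf p) = (W.baseChange ℚ_[p]).kodairaSymbol ℤ_[p] := by
  have h := WeierstrassCurve.kodairaSymbolAt_eq_padic (placeOf p) W
  have hp : ((Rat.HeightOneSpectrum.primesEquiv (placeOf p) : Nat.Primes) : ℕ) = p :=
    congrArg Subtype.val ((Rat.HeightOneSpectrum.primesEquiv (R := ℤ)).apply_symm_apply ⟨p, Fact.out⟩)
  generalize Rat.HeightOneSpectrum.primesEquiv (placeOf p) = q at hp h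
  obtain ⟨q, hq⟩ := q
  simp only at hp
  subst hp
  exact h

section Local

/-- `3ⁿ ∣ x ↔ ϖⁿ ∣ x` in `ℤ₃` for the tree's chosen uniformiser `ϖ`. [folklore] -/
private theorem three_pow_dvd_iff (x : ℤ_[3]) (n : ℕ) :
    (3 : ℤ_[3]) ^ n ∣ x ↔ uniformizer ℤ_[3] ^ n ∣ x := by
  have h3 : Irreducible (3 : ℤ_[3]) := by simpa using PadicInt.irreducible_p (p := 3)
  rw [← mem_maximalIdeal_pow_iff_dvd_of_irreducible h3, mem_maximalIdeal_pow_iff_dvd]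

/-- `3 ∣ x ↔ ϖ ∣ x` in `ℤ₃`. [folklore] -/
private theorem three_dvd_iff (x : ℤ_[3]) : (3 : ℤ_[3]) ∣ x ↔ uniformizer ℤ_[3] ∣ x := by
  simpa using three_pow_dvd_iff x 1

/-- **Type `III` twisted by `3δ` is a Step-9 model of type `III*`.** For `S = y² = x³ + A₂x² + A₄x + A₆` over
`ℤ₃` with `3 ∣ A₂`, `3 ∥ A₄`, `9 ∣ A₆` and `δ ∈ ℤ₃ˣ`, the model `y² = x³ + 3δA₂x² + 9δ²A₄x + 27δ³A₆` has
`9 ∣ a₂`, `27 ∥ a₄`, `3⁵ ∣ a₆`, hence Kodaira symbol `III*` (tree `kodairaSymbolOfMinimal_eq_IIIstar_of_step9`).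
[cite: SilvermanATAEC1994, IV.9.4 Step 9] -/
theorem kodairaSymbolOfMinimal_twistModel_of_III {A₂ A₄ A₆ δ : ℤ_[3]} (h₂ : (3 : ℤ_[3]) ∣ A₂)
    (h₄ : (3 : ℤ_[3]) ∣ A₄) (h₄' : ¬ (3 : ℤ_[3]) ^ 2 ∣ A₄) (h₆ : (3 : ℤ_[3]) ^ 2 ∣ A₆) (hδ : IsUnit δ) :
    (⟨0, 3 * δ * A₂, 0, (3 * δ) ^ 2 * A₄, (3 * δ) ^ 3 * A₆⟩ : WeierstrassCurve ℤ_[3]).kodairaSymbolOfMinimal =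
      .IIIstar := by
  haveI : Finite (ResidueField ℤ_[3]) := Finite.of_equiv _ (PadicInt.residueField (p := 3)).toEquiv.symm
  have h3 : Irreducible (3 : ℤ_[3]) := by simpa using PadicInt.irreducible_p (p := 3)
  have h3p : Prime (3 : ℤ_[3]) := h3.prime
  obtain ⟨a₂, rfl⟩ := h₂
  obtain ⟨a₄, rfl⟩ := h₄
  obtain ⟨a₆, rfl⟩ := h₆
  have ha₄ : ¬ (3 : ℤ_[3]) ∣ a₄ := fun h ↦ h₄' (by rw [pow_two]; exact mul_dvd_mul_left 3 h)
  refine kodairaSymbolOfMinimal_eq_IIIstar_of_step9 (by simp) ?_ (by simp) ?_ ?_ ?_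
  · rw [← three_pow_dvd_iff]; exact ⟨δ * a₂, by ring⟩
  · rw [← three_pow_dvd_iff]; exact ⟨δ ^ 2 * a₄, by ring⟩
  · rw [← three_pow_dvd_iff]; exact ⟨δ ^ 3 * a₆, by ring⟩
  · rw [← three_pow_dvd_iff]
    rintro ⟨c, hc⟩
    have h27 : (3 : ℤ_[3]) ^ 3 * (δ ^ 2 * a₄) = (3 : ℤ_[3]) ^ 3 * (3 * c) := by linear_combination hc
    have hda : δ ^ 2 * a₄ = 3 * c := mul_left_cancel₀ (pow_ne_zero 3 h3.ne_zero) h27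
    have hdvd : (3 : ℤ_[3]) ∣ δ ^ 2 * a₄ := ⟨c, hda⟩
    rcases h3p.dvd_or_dvd hdvd with h | h
    · exact h3.not_isUnit (isUnit_of_dvd_unit h (hδ.pow 2))
    · exact ha₄ h

/-- **Type `III*` twisted by `3δ` and rescaled is a Step-2 model of type `III`.** For
`S = y² = x³ + 9A₂x² + 27A₄x + 3⁵A₆` over `ℤ₃` with `3 ∤ A₄` and `δ ∈ ℤ₃ˣ`, the model
`y² = x³ + 3δA₂x² + 3δ²A₄x + 9δ³A₆` (the twist `y² = x³ + 27δA₂x² + 3⁵δ²A₄x + 3⁸δ³A₆` with `(x, y)` divided by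
`(3², 3³)`) has `3 ∣ b₂, a₄, a₆`, `9 ∣ a₆`, `27 ∤ b₈`, hence Kodaira symbol `III` (tree
`kodairaSymbolOfMinimal_eq_III_of_step2`). [cite: SilvermanATAEC1994, IV.9.4 Steps 2–4] -/
theorem kodairaSymbolOfMinimal_twistModel_of_IIIstar {A₂ A₄ A₆ δ : ℤ_[3]} (ha₄ : ¬ (3 : ℤ_[3]) ∣ A₄)
    (hδ : IsUnit δ) :
    (⟨0, 3 * δ * A₂, 0, 3 * δ ^ 2 * A₄, 9 * δ ^ 3 * A₆⟩ : WeierstrassCurve ℤ_[3]).kodairaSymbolOfMinimal =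
      .III := by
  haveI : Finite (ResidueField ℤ_[3]) := Finite.of_equiv _ (PadicInt.residueField (p := 3)).toEquiv.symm
  have h3 : Irreducible (3 : ℤ_[3]) := by simpa using PadicInt.irreducible_p (p := 3)
  have h3p : Prime (3 : ℤ_[3]) := h3.prime
  set N : WeierstrassCurve ℤ_[3] := ⟨0, 3 * δ * A₂, 0, 3 * δ ^ 2 * A₄, 9 * δ ^ 3 * A₆⟩ with hN
  have hΔ : (3 : ℤ_[3]) ^ 3 ∣ N.Δ :=
    pow_dvd_Δ_of_pow_dvd_a 3 N (i₁ := 10) (i₂ := 1) (i₃ := 10) (i₄ := 1) (i₆ := 2) 3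
      (by simp [hN]) (by rw [pow_one]; exact ⟨δ * A₂, by simp [hN]; ring⟩) (by simp [hN])
      (by rw [pow_one]; exact ⟨δ ^ 2 * A₄, by simp [hN]; ring⟩) (⟨δ ^ 3 * A₆, by simp [hN]; ring⟩)
      1 1 2 2 (by norm_num) (by norm_num) (by norm_num) (by norm_num) (by norm_num) (by norm_num)
      (by norm_num) (by norm_num) (by norm_num) (by norm_num) (by norm_num)
      (by norm_num) (by norm_num) (by norm_num) (by norm_num)
  refine kodairaSymbolOfMinimal_eq_III_of_step2 ?_ (by simp [hN]) ?_ ?_ ?_ ?_ ?_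
  · rw [← three_dvd_iff]; exact (dvd_pow_self 3 three_ne_zero).trans hΔ
  · rw [← three_dvd_iff]; exact ⟨δ ^ 2 * A₄, by simp [hN]; ring⟩
  · rw [← three_dvd_iff]; exact ⟨3 * δ ^ 3 * A₆, by simp [hN]; ring⟩
  · rw [← three_dvd_iff]; exact ⟨4 * δ * A₂, by simp [hN, WeierstrassCurve.b₂]; ring⟩
  · rw [← three_pow_dvd_iff]; exact ⟨δ ^ 3 * A₆, by simp [hN]; ring⟩
  · rw [← three_pow_dvd_iff]
    rintro ⟨c, hc⟩
    have hb₈ : N.b₈ = 9 * (δ ^ 4 * (12 * A₂ * A₆ - A₄ ^ 2)) := by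
      simp [hN, WeierstrassCurve.b₈]; ring
    rw [hb₈, show (3 : ℤ_[3]) ^ 3 * c = 9 * (3 * c) by ring] at hc
    have hX : δ ^ 4 * (12 * A₂ * A₆ - A₄ ^ 2) = 3 * c :=
      mul_left_cancel₀ (by norm_num : (9 : ℤ_[3]) ≠ 0) hc
    have hdvd : (3 : ℤ_[3]) ∣ δ ^ 4 * (12 * A₂ * A₆ - A₄ ^ 2) := ⟨c, hX⟩
    rcases h3p.dvd_or_dvd hdvd with h | h
    · exact h3.not_isUnit (isUnit_of_dvd_unit h (hδ.pow 4))
    · have h' : (3 : ℤ_[3]) ∣ A₄ ^ 2 := by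
        have h12 : (3 : ℤ_[3]) ∣ 12 * A₂ * A₆ := ⟨4 * A₂ * A₆, by ring⟩
        simpa using dvd_sub h12 h
      exact ha₄ (h3p.dvd_of_dvd_pow h')

end Local

section Reading

/-- **The Kodaira symbol at `3` read on a user-supplied `ℤ₃`-model with `ord Δ < 12`.** If
`Wd ⊗ ℚ₃ = E • N` for a `ℤ₃`-model `N` with `Δ(N) ≠ 0` and `3¹² ∤ Δ(N)`, then `N` is a minimal equation
(Silverman *AEC* VII.1 Remark 1.1, tree `isMinimal_of_exp_lt_valuation_Δ`) and `Wd.kodairaSymbolAt (placeOf 3)`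
is Tate's algorithm run on `N` (tree `kodairaSymbol_eq_kodairaSymbolOfMinimal_of_isMinimal`, *AEC* VII.1.3(b)).
[cite: SilvermanAEC2009, VII.1 Remark 1.1 and Prop. 1.3(b)] -/
theorem kodairaSymbolAt_placeOf_three_eq_of_model (Wd : WeierstrassCurve ℚ) [Wd.IsElliptic]
    (N : WeierstrassCurve ℤ_[3]) (E : WeierstrassCurve.VariableChange ℚ_[3])
    (hE : Wd.baseChange ℚ_[3] = E • N.map (algebraMap ℤ_[3] ℚ_[3])) (hN0 : N.Δ ≠ 0)
    (h12 : ¬ (3 : ℤ_[3]) ^ 12 ∣ N.Δ) :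
    Wd.kodairaSymbolAt (placeOf 3) = N.kodairaSymbolOfMinimal := by
  haveI : Finite (ResidueField ℤ_[3]) := Finite.of_equiv _ (PadicInt.residueField (p := 3)).toEquiv.symm
  have h3 : Irreducible (3 : ℤ_[3]) := by simpa using PadicInt.irreducible_p (p := 3)
  set ι := algebraMap ℤ_[3] ℚ_[3] with hι
  haveI hint : (N.map ι).IsIntegral ℤ_[3] := ⟨⟨N, rfl⟩⟩
  -- minimality: `v(Δ(N)) > exp(-12)`
  have hval : WithZero.exp (-12 : ℤ) <
      (IsDiscreteValuationRing.maximalIdeal ℤ_[3]).valuation ℚ_[3] (N.map ι).Δ := by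
    rw [WeierstrassCurve.map_Δ, HeightOneSpectrum.valuation_of_algebraMap]
    by_contra hle
    rw [not_lt, show (-12 : ℤ) = -((12 : ℕ) : ℤ) by norm_num,
      HeightOneSpectrum.intValuation_le_pow_iff_mem] at hle
    have hmem : N.Δ ∈ maximalIdeal ℤ_[3] ^ 12 := hle
    exact h12 ((mem_maximalIdeal_pow_iff_dvd_of_irreducible h3 _ _).mp hmem)
  haveI hmin : (N.map ι).IsMinimal ℤ_[3] := WeierstrassCurve.isMinimal_of_exp_lt_valuation_Δ (N.map ι) hval
  have hΔ0 : (N.map ι).Δ ≠ 0 := by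
    rw [WeierstrassCurve.map_Δ]
    exact fun h ↦ hN0 ((map_eq_zero_iff ι (IsFractionRing.injective ℤ_[3] ℚ_[3])).mp h)
  have hK := WeierstrassCurve.kodairaSymbol_eq_kodairaSymbolOfMinimal_of_isMinimal ℤ_[3]
    (Wd.baseChange ℚ_[3]) (N.map ι) E⁻¹ (by rw [hE, inv_smul_smul]) hΔ0
  have hNint : (N.map ι).integralModel ℤ_[3] = N :=
    WeierstrassCurve.map_injective (IsFractionRing.injective ℤ_[3] ℚ_[3])
      (WeierstrassCurve.baseChange_integralModel_eq ℤ_[3] (N.map ι))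
  rw [kodairaSymbolAt_placeOf_eq_padic, hK, hNint]

end Reading

section Twist

variable (W : WeierstrassCurve ℚ) [W.IsElliptic] [W.IsGloballyMinimal]

/-- **The census Kodaira symbol of a (t′) curve flips `III ↔ III*` under a quadratic twist with
`ord₃ d = 1`.** For `W/ℚ` globally minimal, elliptic, `Addv W 3`, `SubTprime W 3`, `d ∈ ℤ` with `ord₃ d = 1`,
and any elliptic `ℚ`-model `Wd` of `W^{(d)}`: either `W` is `III` at `3` and `Wd` is `III*`, or `W` is `III*`
and `Wd` is `III` (`Wd ⊗ ℚ₃ ≅ (S ⊗ ℚ₃)^{(d)}` for the `ℤ₃` medium form `S` of `W`; the case is decided by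
`ord₃ Δ_min(W) = m + 1 ∈ {3, 9}`, `f₃ = 2`). [cite: SilvermanATAEC1994, IV.9.4 and Table 4.1]
[cite: SilvermanAEC2009, X.5 Cor. 5.4 and VII.1 Prop. 1.3(b)] -/
theorem kodairaSymbolAt_placeOf_three_of_twist (hadd : Addv W 3) (hsub : SubTprime W 3) {d : ℤ}
    (hd : padicValInt 3 d = 1) (Wd : WeierstrassCurve ℚ) [Wd.IsElliptic]
    (hWd : ∃ C : WeierstrassCurve.VariableChange ℚ, C • W.quadraticTwist (d : ℚ) = Wd) :
    (W.kodairaSymbolAt (placeOf 3) = .III ∧ Wd.kodairaSymbolAt (placeOf 3) = .IIIstar) ∨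
      (W.kodairaSymbolAt (placeOf 3) = .IIIstar ∧ Wd.kodairaSymbolAt (placeOf 3) = .III) := by
  classical
  obtain ⟨T, V, hVmap, hA₁, hA₃, hcases⟩ := exists_padicInt_mediumForm_of_subTprime W hadd hsub
  obtain ⟨Cd, hCd⟩ := hWd
  have h3 : Irreducible (3 : ℤ_[3]) := by simpa using PadicInt.irreducible_p (p := 3)
  -- `d = 3 d₀` with `3 ∤ d₀`; `δ = d₀` is a unit of `ℤ₃`
  have hd0 : d ≠ 0 := by rintro rfl; simp at hd
  have h3d : (3 : ℤ) ∣ d := by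
    by_contra h
    rw [padicValInt.eq_zero_of_not_dvd (p := 3) (by exact_mod_cast h)] at hd
    exact zero_ne_one hd
  obtain ⟨d₀, rfl⟩ := h3d
  have hd₀ : ¬ (3 : ℤ) ∣ d₀ := by
    intro h
    have h9 : ((3 : ℕ) : ℤ) ^ 2 ∣ 3 * d₀ := by
      rw [pow_two]; exact mul_dvd_mul_left _ (by exact_mod_cast h)
    rcases (padicValInt_dvd_iff 2 (3 * d₀)).mp h9 with h0 | h2
    · exact hd0 h0
    · omega
  set δ : ℤ_[3] := (d₀ : ℤ_[3]) with hδdef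
  have hδ : IsUnit δ := by
    rw [PadicInt.isUnit_iff]
    have h1 : ‖(d₀ : ℤ_[3])‖ ≤ 1 := PadicInt.norm_le_one _
    have h2 : ¬ ‖(d₀ : ℤ_[3])‖ < 1 := by
      rw [PadicInt.norm_int_lt_one_iff_dvd]; exact_mod_cast hd₀
    exact le_antisymm h1 (not_lt.mp h2)
  set ι := algebraMap ℤ_[3] ℚ_[3] with hι
  set S := T • V with hS
  set W' := W.baseChange ℚ_[3] with hW'
  have hd' : (((3 * d₀ : ℤ) : ℚ) : ℚ_[3]) = ι (3 * δ) := by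
    rw [hδdef, hι, map_mul, map_ofNat, map_intCast]; push_cast; ring
  have hSmap : S.map ι = (T.map ι) • W' := by rw [hS, ← WeierstrassCurve.map_variableChange, hVmap]
  have hW'eq : W' = (T.map ι)⁻¹ • S.map ι := by rw [hSmap, inv_smul_smul]
  have hXeq : Wd.baseChange ℚ_[3] =
      (Cd.map (algebraMap ℚ ℚ_[3])) • W'.quadraticTwist (ι (3 * δ)) := by
    rw [← hCd, WeierstrassCurve.baseChange, ← WeierstrassCurve.map_variableChange,
      WeierstrassCurve.map_quadraticTwist, ← hd', eq_ratCast]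
    rfl
  -- the twisted `ℤ₃`-model `N = y² = x³ + (3δ)A₂x² + (3δ)²A₄x + (3δ)³A₆`
  set N : WeierstrassCurve ℤ_[3] :=
    ⟨0, 3 * δ * S.a₂, 0, (3 * δ) ^ 2 * S.a₄, (3 * δ) ^ 3 * S.a₆⟩ with hNdef
  have hSa₁ : S.a₁ = 0 := hA₁
  have hSa₃ : S.a₃ = 0 := hA₃
  have hN : (S.map ι).quadraticTwist (ι (3 * δ)) = N.map ι := by
    ext
    · simp [hNdef]
    · simp only [WeierstrassCurve.quadraticTwist_a₂, WeierstrassCurve.b₂, WeierstrassCurve.map_a₁,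
        WeierstrassCurve.map_a₂, hSa₁, hNdef, map_zero, map_mul, map_ofNat]
      ring
    · simp [hNdef]
    · simp only [WeierstrassCurve.quadraticTwist_a₄, WeierstrassCurve.b₄, WeierstrassCurve.map_a₁,
        WeierstrassCurve.map_a₃, WeierstrassCurve.map_a₄, hSa₁, hNdef, map_zero, map_mul, map_pow,
        map_ofNat]
      ring
    · simp only [WeierstrassCurve.quadraticTwist_a₆, WeierstrassCurve.b₆, WeierstrassCurve.map_a₃,
        WeierstrassCurve.map_a₆, hSa₃, hNdef, map_zero, map_mul, map_pow, map_ofNat]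
      ring
  set E : WeierstrassCurve.VariableChange ℚ_[3] :=
    Cd.map (algebraMap ℚ ℚ_[3]) * ⟨((T.map ι)⁻¹).u, ι (3 * δ) * ((T.map ι)⁻¹).r, 0, 0⟩ with hEdef
  have hXN : Wd.baseChange ℚ_[3] = E • N.map ι := by
    rw [hXeq, hW'eq, WeierstrassCurve.quadraticTwist_smul, hN, hEdef, mul_smul]
  have hNΔ : N.Δ = (3 * δ) ^ 6 * S.Δ := by
    simp only [WeierstrassCurve.Δ, WeierstrassCurve.b₂, WeierstrassCurve.b₄, WeierstrassCurve.b₆,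
      WeierstrassCurve.b₈, hNdef, hSa₁, hSa₃]
    ring
  have hS0 : S.Δ ≠ 0 := by
    rcases hcases with ⟨-, -, -, -, hv⟩ | ⟨-, -, -, -, hv⟩ <;>
    · intro h0; rw [h0, addVal_zero] at hv; simp at hv
  have haddδ : addVal ℤ_[3] (3 * δ) = 1 := by
    rw [addVal_mul, addVal_uniformizer h3,
      addVal_def δ hδ.unit h3 0 (by rw [pow_zero, mul_one, IsUnit.unit_spec])]
    rfl
  have hN0 : N.Δ ≠ 0 := hNΔ ▸ mul_ne_zero (pow_ne_zero _ (mul_ne_zero h3.ne_zero hδ.ne_zero)) hS0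
  have hordN : (addVal ℤ_[3] N.Δ).toNat = 6 + (addVal ℤ_[3] S.Δ).toNat := by
    have hS : addVal ℤ_[3] S.Δ = ((addVal ℤ_[3] S.Δ).toNat : ℕ∞) :=
      (ENat.coe_toNat (addVal_eq_top_iff.not.mpr hS0)).symm
    rw [hNΔ, addVal_mul, addVal_pow, haddδ, hS]
    simp only [nsmul_eq_mul, Nat.cast_ofNat, mul_one]
    norm_cast
  -- `ord Δ(S) = ord₃ Δ_min(W) = m(W) + 1`
  have hordW : (addVal ℤ_[3] S.Δ).toNat = (W.kodairaSymbolAt (placeOf 3)).numComponents + 1 := by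
    have hWΔ : W.Δ ≠ 0 := W.isUnit_Δ.ne_zero
    have hVΔ : ((V.Δ : ℤ_[3]) : ℚ_[3]) = (W.Δ : ℚ_[3]) := by
      have h := congrArg WeierstrassCurve.Δ hVmap
      rw [WeierstrassCurve.map_Δ, hW', WeierstrassCurve.baseChange, WeierstrassCurve.map_Δ,
        eq_ratCast] at h
      exact h
    have hWΔval : padicValRat 3 W.Δ = ((addVal ℤ_[3] V.Δ).toNat : ℤ) := by
      have h := congrArg Padic.valuation hVΔ
      rw [PadicInt.valuation_coe, Padic.valuation_ratCast] at h
      rw [addVal_toNat_eq_valuation]; exact h.symm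
    have hSV : (addVal ℤ_[3] S.Δ).toNat = (addVal ℤ_[3] V.Δ).toNat := by
      rw [hS, WeierstrassCurve.variableChange_Δ, addVal_mul, addVal_pow,
        addVal_def ((T.u⁻¹ : ℤ_[3]ˣ) : ℤ_[3]) T.u⁻¹ h3 0 (by rw [pow_zero, mul_one])]
      simp
    have hf : W.conductorExponent (placeOf 3) = 2 := hsub.2.1
    unfold WeierstrassCurve.conductorExponent WeierstrassCurve.numComponentsAt at hf
    have hord : (W.ordMinimalDiscriminant (placeOf 3) : ℤ) = ((addVal ℤ_[3] S.Δ).toNat : ℤ) := by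
      rw [ordMinimalDiscriminant_placeOf_eq W 3, ← padicValRat_Δ_eq W 3, hWΔval, hSV]
    have hord' : W.ordMinimalDiscriminant (placeOf 3) = (addVal ℤ_[3] S.Δ).toNat := by exact_mod_cast hord
    have hpos := (W.kodairaSymbolAt (placeOf 3)).numComponents_pos
    omega
  rcases hcases with ⟨h₂, h₄, h₄', h₆, hv⟩ | ⟨h₂, h₄, h₄', h₆, hv⟩
  · -- `W` is `III` (`ord Δ = 3`), the twisted model `N` is a minimal model of type `III*`
    left
    have hKW : W.kodairaSymbolAt (placeOf 3) = .III := by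
      rcases (subTprime_three_iff_kodairaSymbolAt_III_or_IIIstar W hadd).mp hsub with h | h
      · exact h
      · rw [h, hv] at hordW; simp [KodairaSymbol.numComponents] at hordW
    refine ⟨hKW, ?_⟩
    have h9 : (addVal ℤ_[3] N.Δ).toNat = 9 := by rw [hordN, hv]
    have h12 : ¬ (3 : ℤ_[3]) ^ 12 ∣ N.Δ := fun h ↦ by have := le_addVal_toNat_of_pow_dvd h3 hN0 h; omega
    rw [kodairaSymbolAt_placeOf_three_eq_of_model Wd N E hXN hN0 h12, hNdef]
    exact kodairaSymbolOfMinimal_twistModel_of_III h₂ h₄ h₄' h₆ hδ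
  · -- `W` is `III*` (`ord Δ = 9`); the twisted model rescaled by `u = 3` is minimal of type `III`
    right
    have hKW : W.kodairaSymbolAt (placeOf 3) = .IIIstar := by
      rcases (subTprime_three_iff_kodairaSymbolAt_III_or_IIIstar W hadd).mp hsub with h | h
      · rw [h, hv] at hordW; simp [KodairaSymbol.numComponents] at hordW
      · exact h
    refine ⟨hKW, ?_⟩
    obtain ⟨a₂, ha₂⟩ := h₂
    obtain ⟨a₄, ha₄⟩ := h₄
    obtain ⟨a₆, ha₆⟩ := h₆
    have ha₄' : ¬ (3 : ℤ_[3]) ∣ a₄ := fun h ↦ h₄' (by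
      rw [ha₄, show (3 : ℤ_[3]) ^ 4 = 3 ^ 3 * 3 by ring]; exact mul_dvd_mul_left _ h)
    set N' : WeierstrassCurve ℤ_[3] := ⟨0, 3 * δ * a₂, 0, 3 * δ ^ 2 * a₄, 9 * δ ^ 3 * a₆⟩ with hN'def
    have h30 : (3 : ℚ_[3]) ≠ 0 := by norm_num
    set C3 : WeierstrassCurve.VariableChange ℚ_[3] := ⟨Units.mk0 3 h30, 0, 0, 0⟩ with hC3
    have hC3u : (↑C3.u⁻¹ : ℚ_[3]) = 3⁻¹ := by simp [hC3]
    have hN'map : N'.map ι = C3 • N.map ι := by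
      ext
      · simp [hN'def, hNdef, hC3, WeierstrassCurve.variableChange_a₁]
      · rw [WeierstrassCurve.variableChange_a₂, hC3u]
        simp only [WeierstrassCurve.map_a₁, WeierstrassCurve.map_a₂, hN'def, hNdef, hC3, ha₂,
          map_mul, map_pow, map_ofNat]
        field_simp
        ring
      · simp [hN'def, hNdef, hC3, WeierstrassCurve.variableChange_a₃]
      · rw [WeierstrassCurve.variableChange_a₄, hC3u]
        simp only [WeierstrassCurve.map_a₁, WeierstrassCurve.map_a₂, WeierstrassCurve.map_a₃,
          WeierstrassCurve.map_a₄, hN'def, hNdef, hC3, ha₄, map_mul, map_pow, map_ofNat, map_zero]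
        field_simp
        ring
      · rw [WeierstrassCurve.variableChange_a₆, hC3u]
        simp only [WeierstrassCurve.map_a₁, WeierstrassCurve.map_a₂, WeierstrassCurve.map_a₃,
          WeierstrassCurve.map_a₄, WeierstrassCurve.map_a₆, hN'def, hNdef, hC3, ha₆, map_mul, map_pow,
          map_ofNat, map_zero]
        field_simp
        ring
    have hXN' : Wd.baseChange ℚ_[3] = (E * C3⁻¹) • N'.map ι := by
      rw [mul_smul, hN'map, inv_smul_smul, ← hXN]
    -- `3¹² Δ(N') = Δ(N)`, so `ord Δ(N') = 15 - 12 = 3`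
    have hΔ' : (3 : ℤ_[3]) ^ 12 * N'.Δ = N.Δ := by
      have h := congrArg WeierstrassCurve.Δ hN'map
      rw [WeierstrassCurve.map_Δ, WeierstrassCurve.variableChange_Δ, hC3u, WeierstrassCurve.map_Δ] at h
      apply IsFractionRing.injective ℤ_[3] ℚ_[3]
      change ι ((3 : ℤ_[3]) ^ 12 * N'.Δ) = ι N.Δ
      rw [map_mul, map_pow, map_ofNat, h, ← mul_assoc, ← mul_pow, mul_inv_cancel₀ h30, one_pow,
        one_mul]
    have hN'0 : N'.Δ ≠ 0 := fun h ↦ hN0 (by rw [← hΔ', h, mul_zero])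
    have h15 : (addVal ℤ_[3] N.Δ).toNat = 15 := by rw [hordN, hv]
    have hordN' : (addVal ℤ_[3] N'.Δ).toNat = 3 := by
      set k := (addVal ℤ_[3] N'.Δ).toNat with hk
      have hN'c : addVal ℤ_[3] N'.Δ = (k : ℕ∞) := (ENat.coe_toNat (addVal_eq_top_iff.not.mpr hN'0)).symm
      have h : addVal ℤ_[3] ((3 : ℤ_[3]) ^ 12 * N'.Δ) = ((12 + k : ℕ) : ℕ∞) := by
        rw [addVal_mul, addVal_pow, addVal_uniformizer h3, hN'c, nsmul_one, Nat.cast_add]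
      have h' := congrArg ENat.toNat h
      rw [hΔ', ENat.toNat_coe, h15] at h'
      omega
    have h12 : ¬ (3 : ℤ_[3]) ^ 12 ∣ N'.Δ := fun h ↦ by have := le_addVal_toNat_of_pow_dvd h3 hN'0 h; omega
    rw [kodairaSymbolAt_placeOf_three_eq_of_model Wd N' (E * C3⁻¹) hXN' hN'0 h12, hN'def]
    exact kodairaSymbolOfMinimal_twistModel_of_IIIstar ha₄' hδ

/-- **The census class (t′) at `3` is preserved by a quadratic twist with `ord₃ d = 1`.** For `W/ℚ`
globally minimal, elliptic, additive at `3` of class (t′), `d ∈ ℤ` with `ord₃ d = 1`, and any globally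
minimal model `Wd` of `W^{(d)}`: `Wd` is additive at `3` of class (t′) (symbol `III*`/`III` at `3`; additivity by
the prime/place bridges and `isAdditive_kodairaSymbolAt_iff_holds`; (t′) by the b2b dictionary). This is the
local shape at `3` of the admissible twist of `stub_twistDatum`. [cite: SilvermanATAEC1994, IV.9.4 and Table 4.1]
[cite: SilvermanAEC2009, VII.5 Prop. 5.1] -/
theorem addv_and_subTprime_of_twist_three (hadd : Addv W 3) (hsub : SubTprime W 3) {d : ℤ}
    (hd : padicValInt 3 d = 1) (Wd : WeierstrassCurve ℚ) [Wd.IsElliptic] [Wd.IsGloballyMinimal]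
    (hWd : ∃ C : WeierstrassCurve.VariableChange ℚ, C • W.quadraticTwist (d : ℚ) = Wd) :
    Addv Wd 3 ∧ SubTprime Wd 3 := by
  have hK : Wd.kodairaSymbolAt (placeOf 3) = .III ∨ Wd.kodairaSymbolAt (placeOf 3) = .IIIstar := by
    rcases kodairaSymbolAt_placeOf_three_of_twist W hadd hsub hd Wd hWd with ⟨-, h⟩ | ⟨-, h⟩
    · exact Or.inr h
    · exact Or.inl h
  have hA : (Wd.kodairaSymbolAt (placeOf 3)).IsAdditive := by
    rcases hK with h | h <;> rw [h] <;>
      simp [KodairaSymbol.IsAdditive, KodairaSymbol.IsGood, KodairaSymbol.IsMultiplicative]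
  have hadd' := (WeierstrassCurve.isAdditive_kodairaSymbolAt_iff_holds (placeOf 3) Wd).mp hA
  have haddv : Addv Wd 3 :=
    ⟨fun hg ↦ hadd'.not_hasGoodReductionAt
        ((Wd.hasGoodReductionAtPrime_iff_hasGoodReductionAt_holds ⟨3, Fact.out⟩).mp hg),
      fun hm ↦ hadd'.not_hasMultiplicativeReductionAt
        ((Wd.hasMultiplicativeReductionAtPrime_iff_hasMultiplicativeReductionAt_holds ⟨3, Fact.out⟩).mp hm)⟩
  exact ⟨haddv, (subTprime_three_iff_kodairaSymbolAt_III_or_IIIstar Wd haddv).mpr hK⟩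

end Twist

end Summit.BirchSwinnertonDyer.BirchSwinnertonDyer.Theorems.SolventPairLowerBound

end
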